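import Summits.Ventures.PercRepro.S1RowSevenAll
import Summits.Ventures.PercRepro.S1CoreLPRowsFreeEight

/-!
# PercRepro — THE RANK-`8` CORE AT EVERY CORANK, END `8`, END `7`: `C-025` AT LEVEL `4` FOR EVERY `p ≥ 6` (p2, gen 29;
SUBCLAIM-S1 §6.10 (xviii)(i))

An `e`-free core of rank `8` has at most `175` points (the cover recursion `ncard_le_two_mul_add_one_of_free` twice
from the rank-`5` bound `21`… via `43` and `87`), so its corank runs over `5 … 167`: the cells `(8, 5) … (8, 29)` by
the coloop/closure LP (`rls_eight_four_of_<n>_all`, `rls_free_8_<n>_all`) and `(8, 30) … (8, 167)` by the kernel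
tables `cellOK8 8 d = true` (`rls_of_cellOK8`). Then `rls_succ_fixed 3 4 8` gives **`c025_four_eight_fixed`**, and
with END 9 (`c025_four_nine`) and level `4` at rank `7` (`c025_four_seven_fixed`): **`c025_four_eight (8 ≤ p)`**,
**`c025_four_seven (7 ≤ p)`**, and **`c025_four_all (6 ≤ p) : ThmN.RLS M p 4`** — the whole `q = 4` row (`(6, 4)` is
`SixFour.rls_six_four_holds`).

* `ncard_le_of_eRank_le_eight_of_free`, `table_8_30_100`, `table_8_101_167`; **`c025_core_four_eight`**,
  **`c025_four_eight_fixed`**, **`c025_four_eight`**, **`c025_four_seven`**, **`c025_four_all`**.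
Axioms: standard.
-/

open scoped Matroid

namespace PercRepro

namespace S1

open Set

variable {α : Type}

/-- An `e`-free core of rank `≤ 8` has at most `175` points. -/
theorem ncard_le_of_eRank_le_eight_of_free (M : Matroid α) [M.Finite]
    (hfree : ∀ e ∈ M.E, ∃ A ⊆ M.E \ {e}, e ∉ M.closure A ∧ e ∉ M.closure ((M.E \ {e}) \ A))
    (hR : M.eRank ≤ 8) : M.E.ncard ≤ 175 :=
  ThmN.ncard_le_two_mul_add_one_of_free M hfree (k := 7) (B := 87)
    (fun Y hY hrY => ThmN.ncard_le_two_mul_add_one_of_free M hfree (k := 6) (B := 43)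
      (fun Z hZ hrZ => ThmN.ncard_le_fortythree_of_eRk_le_six_of_free M hfree hZ hrZ) Y hY hrY)
    M.E subset_rfl (by rw [← M.eRank_def]; exact hR)

/-- `cellOK8 8 d` for `30 ≤ d ≤ 100` (kernel). -/
theorem table_8_30_100 : ∀ d < 101, 30 ≤ d → cellOK8 8 d = true := by decide +kernel

/-- `cellOK8 8 d` for `101 ≤ d ≤ 167` (kernel). -/
theorem table_8_101_167 : ∀ d < 168, 101 ≤ d → cellOK8 8 d = true := by decide +kernel

/-- **THE CORE OF RANK `8` AT EVERY CORANK `d ≥ 5`**. -/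
theorem c025_core_four_eight (M : Matroid α) [M.Finite] (hR : M.eRank = ((8 : ℕ) : ℕ∞))
    (hbig : 8 + 4 < M.E.ncard)
    (hfree : ∀ e ∈ M.E, ∃ A ⊆ M.E \ {e}, e ∉ M.closure A ∧ e ∉ M.closure ((M.E \ {e}) \ A)) :
    ThmN.RLS M 8 4 := by
  have hmax : M.E.ncard ≤ 175 := ncard_le_of_eRank_le_eight_of_free M hfree (by rw [hR]; exact le_refl _)
  set d := M.E.ncard - 8 with hd
  have hn : M.E.ncard = 8 + d := by omega
  rcases Nat.lt_or_ge d 6 with h5 | h5'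
  · exact rls_eight_four_of_thirteen_all M hR (by omega) (pairs_of_free M hfree) (lines_of_free M hfree)
  rcases Nat.lt_or_ge d 7 with h6 | h6'
  · exact rls_eight_four_of_fourteen_all M hR (by omega) (pairs_of_free M hfree) (lines_of_free M hfree)
  rcases Nat.lt_or_ge d 8 with h7 | h7'
  · exact rls_eight_four_of_fifteen_all M hR (by omega) (pairs_of_free M hfree) (lines_of_free M hfree)
  rcases Nat.lt_or_ge d 9 with h8 | h8'
  · exact rls_eight_four_of_sixteen_all M hR (by omega) (pairs_of_free M hfree) (lines_of_free M hfree)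
  rcases Nat.lt_or_ge d 10 with h9 | h9'
  · exact rls_eight_four_of_seventeen_all M hR (by omega) (pairs_of_free M hfree) (lines_of_free M hfree)
  rcases Nat.lt_or_ge d 11 with h10 | h10'
  · exact rls_free_8_18_all M hR (by omega) (pairs_of_free M hfree) (lines_of_free M hfree) (planes_of_free M hfree) (tens_of_free M hfree) (sparse_of_free M hfree)
  rcases Nat.lt_or_ge d 12 with h11 | h11'
  · exact rls_free_8_19_all M hR (by omega) (pairs_of_free M hfree) (lines_of_free M hfree) (planes_of_free M hfree) (tens_of_free M hfree) (sparse_of_free M hfree)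
  rcases Nat.lt_or_ge d 13 with h12 | h12'
  · exact rls_free_8_20_all M hR (by omega) (pairs_of_free M hfree) (lines_of_free M hfree) (planes_of_free M hfree) (tens_of_free M hfree) (sparse_of_free M hfree)
  rcases Nat.lt_or_ge d 14 with h13 | h13'
  · exact rls_free_8_21_all M hR (by omega) (pairs_of_free M hfree) (lines_of_free M hfree) (planes_of_free M hfree) (tens_of_free M hfree) (sparse_of_free M hfree)
  rcases Nat.lt_or_ge d 15 with h14 | h14'
  · exact rls_free_8_22_all M hR (by omega) (pairs_of_free M hfree) (lines_of_free M hfree) (planes_of_free M hfree) (tens_of_free M hfree) (sparse_of_free M hfree)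
  rcases Nat.lt_or_ge d 16 with h15 | h15'
  · exact rls_free_8_23_all M hR (by omega) (pairs_of_free M hfree) (lines_of_free M hfree) (planes_of_free M hfree) (tens_of_free M hfree) (sparse_of_free M hfree)
  rcases Nat.lt_or_ge d 17 with h16 | h16'
  · exact rls_free_8_24_all M hR (by omega) (pairs_of_free M hfree) (lines_of_free M hfree) (planes_of_free M hfree) (tens_of_free M hfree) (sparse_of_free M hfree)
  rcases Nat.lt_or_ge d 18 with h17 | h17'
  · exact rls_free_8_25_all M hR (by omega) (pairs_of_free M hfree) (lines_of_free M hfree) (planes_of_free M hfree) (tens_of_free M hfree) (sparse_of_free M hfree)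
  rcases Nat.lt_or_ge d 19 with h18 | h18'
  · exact rls_free_8_26_all M hR (by omega) (pairs_of_free M hfree) (lines_of_free M hfree) (planes_of_free M hfree) (tens_of_free M hfree) (sparse_of_free M hfree)
  rcases Nat.lt_or_ge d 20 with h19 | h19'
  · exact rls_free_8_27_all M hR (by omega) (pairs_of_free M hfree) (lines_of_free M hfree) (planes_of_free M hfree) (tens_of_free M hfree) (sparse_of_free M hfree)
  rcases Nat.lt_or_ge d 21 with h20 | h20'
  · exact rls_free_8_28_all M hR (by omega) (pairs_of_free M hfree) (lines_of_free M hfree) (planes_of_free M hfree) (tens_of_free M hfree) (sparse_of_free M hfree)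
  rcases Nat.lt_or_ge d 22 with h21 | h21'
  · exact rls_free_8_29_all M hR (by omega) (pairs_of_free M hfree) (lines_of_free M hfree) (planes_of_free M hfree) (tens_of_free M hfree) (sparse_of_free M hfree)
  rcases Nat.lt_or_ge d 23 with h22 | h22'
  · exact rls_free_8_30_all M hR (by omega) (pairs_of_free M hfree) (lines_of_free M hfree) (planes_of_free M hfree) (tens_of_free M hfree) (sparse_of_free M hfree)
  rcases Nat.lt_or_ge d 24 with h23 | h23'
  · exact rls_free_8_31_all M hR (by omega) (pairs_of_free M hfree) (lines_of_free M hfree) (planes_of_free M hfree) (tens_of_free M hfree) (sparse_of_free M hfree)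
  rcases Nat.lt_or_ge d 25 with h24 | h24'
  · exact rls_free_8_32_all M hR (by omega) (pairs_of_free M hfree) (lines_of_free M hfree) (planes_of_free M hfree) (tens_of_free M hfree) (sparse_of_free M hfree)
  rcases Nat.lt_or_ge d 26 with h25 | h25'
  · exact rls_free_8_33_all M hR (by omega) (pairs_of_free M hfree) (lines_of_free M hfree) (planes_of_free M hfree) (tens_of_free M hfree) (sparse_of_free M hfree)
  rcases Nat.lt_or_ge d 27 with h26 | h26'
  · exact rls_free_8_34_all M hR (by omega) (pairs_of_free M hfree) (lines_of_free M hfree) (planes_of_free M hfree) (tens_of_free M hfree) (sparse_of_free M hfree)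
  rcases Nat.lt_or_ge d 28 with h27 | h27'
  · exact rls_free_8_35_all M hR (by omega) (pairs_of_free M hfree) (lines_of_free M hfree) (planes_of_free M hfree) (tens_of_free M hfree) (sparse_of_free M hfree)
  rcases Nat.lt_or_ge d 29 with h28 | h28'
  · exact rls_free_8_36_all M hR (by omega) (pairs_of_free M hfree) (lines_of_free M hfree) (planes_of_free M hfree) (tens_of_free M hfree) (sparse_of_free M hfree)
  rcases Nat.lt_or_ge d 30 with h29 | h29'
  · exact rls_free_8_37_all M hR (by omega) (pairs_of_free M hfree) (lines_of_free M hfree) (planes_of_free M hfree) (tens_of_free M hfree) (sparse_of_free M hfree)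
  rcases Nat.lt_or_ge d 101 with h101 | h101
  · exact rls_of_cellOK8 M 8 d (by omega) hR hn hfree (by norm_num) (table_8_30_100 d h101 (by omega))
  · exact rls_of_cellOK8 M 8 d (by omega) hR hn hfree (by norm_num) (table_8_101_167 d (by omega) h101)

/-- **LEVEL `4` AT RANK `8`** for every finite matroid. -/
theorem c025_four_eight_fixed (M : Matroid α) [M.Finite] : ThmN.RLS M 8 4 := by
  refine rls_succ_fixed (α := α) 3 4 8 (by omega) ?_ ?_ ?_ M
  · intro M' _
    exact SevenThree.c025_three_all M' 7 (by omega)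
  · intro M' _ hn
    rcases Nat.lt_or_ge M'.E.ncard (8 + 4) with h | h
    · exact ThmN.RLS_of_ncard_lt M' h
    · exact ThmN.RLS_of_ncard_eq M' (by omega)
  · intro M' _ hR hbig hfree
    exact c025_core_four_eight M' hR hbig hfree

/-- **END 8**: `C-025` at level `4` for every finite matroid and every `p ≥ 8`. -/
theorem c025_four_eight (M : Matroid α) [M.Finite] (p : ℕ) (hp : 8 ≤ p) : ThmN.RLS M p 4 := by
  rcases Nat.lt_or_ge p 9 with h | h
  · have h8 : p = 8 := by omega
    subst h8
    exact c025_four_eight_fixed M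
  · exact c025_four_nine M p h

/-- **END 7**: `C-025` at level `4` for every finite matroid and every `p ≥ 7`. -/
theorem c025_four_seven (M : Matroid α) [M.Finite] (p : ℕ) (hp : 7 ≤ p) : ThmN.RLS M p 4 := by
  rcases Nat.lt_or_ge p 8 with h | h
  · have h7 : p = 7 := by omega
    subst h7
    exact c025_four_seven_fixed M
  · exact c025_four_eight M p h

/-- **THE WHOLE `q = 4` ROW**: `C-025` at level `4` for every finite matroid and every `p ≥ 6`. -/
theorem c025_four_all (M : Matroid α) [M.Finite] (p : ℕ) (hp : 6 ≤ p) : ThmN.RLS M p 4 := by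
  rcases Nat.lt_or_ge p 7 with h | h
  · have h6 : p = 6 := by omega
    subst h6
    exact SixFour.rls_six_four_holds M
  · exact c025_four_seven M p h

end S1

end PercRepro
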